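import Literature.NumberTheory.DiophantineGeometry.GenEllCuspTransfer
import HarnessLib

/-!
# [GenEll] Thm. 2.1, proof: the transfer along the `S₃`-conjugate power maps `x ↦ 1 − (1−x)^n` and
# `x ↦ x^n/(x^n − (x−1)^n)`

S. Mochizuki, *Arithmetic elliptic curves in general position*, Math. J. Okayama Univ. 52 (2010)
[cite: MochizukiGenEll2010, Thm 2.1 pp.11–13]. Instances of the transfer lemma
(`GenEllCuspTransfer.vojtaIneq_transfer`) for the two conjugates of the power map `x ↦ x^n` by the
automorphisms `x ↦ 1 − x` and `x ↦ x/(x−1)` of `(ℙ¹, {0,1,∞})`: `γ'_n(x) = 1 − (1−x)^n` (fixing `1, ∞`;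
torsion locus `1 − μ_∞`) and `γ''_n(x) = x^n/(x^n − (x−1)^n) = M((Mx)^n)`, `M(x) = x/(x−1)` (fixing
`0, 1`; torsion locus `μ_∞/(μ_∞ − 1)`). Both are cusp-preserving Belyi maps of degree `n` with reduced
pullback `C + B`, `deg B = n − 1`; the certificates are `B' = V(Σ_{i<n} (1−t)^i)` with
`(1 − (1−t)^n)·(−(1−t)^n)·(−1)^{n+1}(1 − (1−t)^n)^{n−1} = ((t²−t)·B')^n`, and `B'' = V(t^n − (t−1)^n)` with
`t^n (t^n − (t−1)^n)(t−1)^n · (B'')^{n−1} = ((t²−t)·B'')^n`. The height lower bounds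
`n·h(x) ≤ h(γ(x)) + O([K:ℚ])` come from `h(x^n) = n h(x)` and the elementary
`|h(1 − z) − h(z)|, |h(z/(z−1)) − h(z)| ≤ 2 log 2·[K:ℚ]` (Mathlib `logHeight₁_sub_le`). Results:
`vojtaIneq_transfer_oneSubPow`, `vojtaIneq_transfer_powDivPow` — Vojta with `ε` on `T` ⟹ Vojta with
`(1+ε)/(1 − ε(n−1)) − 1` on the points whose `γ`-image (re-presented over its minimal field) lies in `T`.
These are the second and third "power families" of the menu of the cell's ℙ¹-route for GenEllTwo.
Classical; abc-iut cell, route item GenEllTwo (stmt-ABC-19679), work package W2; nothing here bears on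
[IUTchIII] Cor. 3.12.
-/

noncomputable section

open NumberField Height Polynomial Finset

namespace Literature.NumberTheory.DiophantineGeometry.GenEll

/-! ## `γ'_n : x ↦ 1 − (1 − x)^n` -/

namespace P1FiniteMap

/-- The map `γ'_n = (1 − (1−t)^n : 1) : ℙ¹ → ℙ¹`, `x ↦ 1 − (1−x)^n` — the conjugate of `x ↦ x^n` by
`x ↦ 1 − x`. [cite: MochizukiGenEll2010, Thm 2.1 p.13] -/
def oneSubPow (n : ℕ) : P1FiniteMap where
  num := 1 - (1 - X) ^ n
  den := 1
  deg := n
  natDegree_num_le := (natDegree_sub_le _ _).trans (max_le (by rw [natDegree_one]; exact n.zero_le)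
    (natDegree_pow_le.trans (by
      have : (1 - X : ℤ[X]).natDegree ≤ 1 :=
        (natDegree_sub_le _ _).trans (by rw [natDegree_one, natDegree_X]; norm_num)
      calc n * (1 - X : ℤ[X]).natDegree ≤ n * 1 := Nat.mul_le_mul_left n this
        _ = n := mul_one n)))
  natDegree_den_le := by rw [natDegree_one]; exact Nat.zero_le _

/-- `γ'_n(x) = 1 − (1−x)^n`. [cite: MochizukiGenEll2010, Thm 2.1 p.13] -/
@[simp] theorem eval_oneSubPow (n : ℕ) {F : Type*} [Field F] (x : F) :
    (oneSubPow n).eval x = 1 - (1 - x) ^ n := by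
  simp [eval, oneSubPow]

/-- `t · Σ_{i<n} (1−t)^i = 1 − (1−t)^n`. [folklore] -/
private theorem X_mul_geom_sum_one_sub (n : ℕ) :
    (X : ℤ[X]) * ∑ i ∈ range n, (1 - X) ^ i = 1 - (1 - X) ^ n := by
  have h := geom_sum_mul (1 - X : ℤ[X]) n
  -- `h : (Σ (1−X)^i) * ((1 − X) − 1) = (1−X)^n − 1`
  have h' : (∑ i ∈ range n, (1 - X : ℤ[X]) ^ i) * X = 1 - (1 - X) ^ n := by
    have : ((1 - X : ℤ[X]) - 1) = -X := by ring
    rw [this, mul_neg] at h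
    linear_combination -h
  rw [mul_comm, h']

/-- `1 − (1−t)^n ≠ 0` for every `n` (value `1` at `t = 1`). [folklore] -/
private theorem one_sub_one_sub_X_pow_ne_zero (n : ℕ) (hn : 1 ≤ n) : (1 - (1 - X) ^ n : ℤ[X]) ≠ 0 := by
  intro h
  have := congrArg (Polynomial.eval 1) h
  simp only [eval_sub, eval_one, eval_pow, eval_X, sub_self, eval_zero] at this
  rw [zero_pow (by omega), sub_zero] at this
  exact one_ne_zero this

/-- THE REDUCED-PULLBACK CERTIFICATE of `γ'_n`: `B' = V(Σ_{i<n} (1−t)^i)` (the points `1 − ζ`,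
`ζ ∈ μ_n ∖ {1}`), `deg B' = n − 1`, `k = n`, `c = 1`, `h = (−1)^{n+1}(1 − (1−t)^n)^{n−1}`.
[cite: MochizukiGenEll2010, Prop 1.7 p.9] -/
def oneSubPowReduced (n : ℕ) (hn : 1 ≤ n) : ReducedPullback (oneSubPow n) where
  B := { poly := ∑ i ∈ range n, (1 - X) ^ i
         deg := n - 1
         natDegree_le := natDegree_sum_le_of_forall_le _ _ fun i hi => by
           have hi' := mem_range.mp hi
           refine natDegree_pow_le.trans ?_
           have : (1 - X : ℤ[X]).natDegree ≤ 1 :=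
             (natDegree_sub_le _ _).trans (by rw [natDegree_one, natDegree_X]; norm_num)
           calc i * (1 - X : ℤ[X]).natDegree ≤ i * 1 := Nat.mul_le_mul_left i this
             _ ≤ n - 1 := by omega }
  k := n
  one_le_k := hn
  c := 1
  c_ne_zero := one_ne_zero
  h := C ((-1) ^ (n + 1)) * (1 - (1 - X) ^ n) ^ (n - 1)
  hdiv := by
    change (1 - (1 - X) ^ n) * 1 * ((1 - (1 - X) ^ n) - 1) *
        (C ((-1 : ℤ) ^ (n + 1)) * (1 - (1 - X) ^ n) ^ (n - 1)) =
      C 1 * ((X ^ 2 - X) * ∑ i ∈ range n, (1 - X) ^ i) ^ n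
    set f : ℤ[X] := 1 - (1 - X) ^ n with hf
    have hB : (X ^ 2 - X : ℤ[X]) * ∑ i ∈ range n, (1 - X) ^ i = -(1 - X) * f := by
      rw [show (X ^ 2 - X : ℤ[X]) = -(1 - X) * X by ring, mul_assoc, X_mul_geom_sum_one_sub]
    have hfn : f * f ^ (n - 1) = f ^ n := by
      rw [← pow_succ', Nat.sub_add_cancel hn]
    rw [hB, map_one, one_mul, mul_one, map_pow, map_neg, map_one, mul_pow, neg_pow (1 - X : ℤ[X])]
    calc f * (f - 1) * ((-1) ^ (n + 1) * f ^ (n - 1))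
        = (f - 1) * (-1) ^ (n + 1) * (f * f ^ (n - 1)) := by ring
      _ = (f - 1) * (-1) ^ (n + 1) * f ^ n := by rw [hfn]
      _ = (-1) ^ n * (1 - X) ^ n * f ^ n := by rw [hf]; ring
  hdeg := by
    change (C ((-1 : ℤ) ^ (n + 1)) * (1 - (1 - X) ^ n) ^ (n - 1)).natDegree + 3 * n ≤ n * (3 + (n - 1))
    have h1 : (1 - (1 - X) ^ n : ℤ[X]).natDegree ≤ n := (oneSubPow n).natDegree_num_le
    have h2 : (C ((-1 : ℤ) ^ (n + 1)) * (1 - (1 - X) ^ n) ^ (n - 1)).natDegree ≤ (n - 1) * n :=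
      natDegree_mul_le.trans (by
        rw [natDegree_C, zero_add]
        exact natDegree_pow_le.trans (Nat.mul_le_mul_left _ h1))
    have h3 : n * (3 + (n - 1)) = (n - 1) * n + 3 * n := by ring
    omega
  j := 1
  hBdiv := by
    change (∑ i ∈ range n, (1 - X) ^ i : ℤ[X]) ∣ ((1 - (1 - X) ^ n) * 1 * ((1 - (1 - X) ^ n) - 1)) ^ 1
    rw [pow_one, mul_one]
    exact Dvd.dvd.mul_right ⟨X, by rw [mul_comm, X_mul_geom_sum_one_sub]⟩ _
  ne_zero := by
    change ((1 - (1 - X) ^ n) * 1 * ((1 - (1 - X) ^ n) - 1) : ℤ[X]) ≠ 0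
    rw [mul_one, show ((1 - (1 - X) ^ n) - 1 : ℤ[X]) = -(1 - X) ^ n by ring]
    refine mul_ne_zero (one_sub_one_sub_X_pow_ne_zero n hn) (neg_ne_zero.mpr (pow_ne_zero _ ?_))
    rw [← C_1]
    exact (monic_X_sub_C (1 : ℤ)).ne_zero ∘ fun h => by
      rw [show (C 1 - X : ℤ[X]) = -(X - C 1) by ring] at h; exact neg_eq_zero.mp h

/-- `deg B' = n − 1`. [cite: MochizukiGenEll2010, Prop 1.7 p.9] -/
@[simp] theorem oneSubPowReduced_B_deg (n : ℕ) (hn : 1 ≤ n) :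
    (oneSubPowReduced n hn).B.deg = n - 1 := rfl

end P1FiniteMap

namespace NFPoint

/-- THE HEIGHT LOWER BOUND for `γ'_n`: `n·ht(x) ≤ ht(γ'_n(x)) + (n+1)·log 2`
(`h(1−y) ≥ h(y) − [F:ℚ] log 2`, `h((1−x)^n) = n·h(1−x) ≥ n(h(x) − [F:ℚ] log 2)`;
[GenEll] Prop. 1.4 (i), (iii)). [cite: MochizukiGenEll2010, Prop 1.4 (i) p.6] -/
theorem hlow_oneSubPow (n : ℕ) : ∀ P : NFPoint, P.OffDiv (P1FiniteMap.oneSubPow n).pullbackCusps →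
    ((P1FiniteMap.oneSubPow n).deg : ℝ) * P.ht ≤
      (P.degree : ℝ)⁻¹ * logHeight₁ ((P1FiniteMap.oneSubPow n).eval P.x) + (n + 1) * Real.log 2 := by
  intro P _
  rw [P1FiniteMap.eval_oneSubPow]
  change (n : ℝ) * ((P.degree : ℝ)⁻¹ * logHeight₁ P.x) ≤ _
  set x := P.x
  have htw : (totalWeight P.F : ℝ) = P.degree := by
    rw [NumberField.totalWeight_eq_finrank]; rfl
  -- `h(x) ≤ tw log 2 + h(1 − x)`
  have h1 : logHeight₁ x ≤ totalWeight P.F * Real.log 2 + logHeight₁ (1 - x) := by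
    have := logHeight₁_sub_le (1 : P.F) (1 - x)
    rw [sub_sub_cancel, logHeight₁_one, add_zero] at this
    exact this
  -- `h((1−x)^n) ≤ tw log 2 + h(1 − (1−x)^n)`
  have h2 : logHeight₁ ((1 - x) ^ n) ≤ totalWeight P.F * Real.log 2 + logHeight₁ (1 - (1 - x) ^ n) := by
    have := logHeight₁_sub_le (1 : P.F) (1 - (1 - x) ^ n)
    rw [sub_sub_cancel, logHeight₁_one, add_zero] at this
    exact this
  rw [logHeight₁_pow] at h2
  rw [htw] at h1 h2
  have hd : (0 : ℝ) < P.degree := Nat.cast_pos.mpr P.degree_pos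
  have hn0 : (0 : ℝ) ≤ n := Nat.cast_nonneg n
  -- `n h(x) ≤ n tw log2 + n h(1−x) ≤ (n+1) tw log 2 + h(1 − (1−x)^n)`
  have h3 : (n : ℝ) * logHeight₁ x ≤ (n + 1) * (P.degree * Real.log 2) + logHeight₁ (1 - (1 - x) ^ n) := by
    nlinarith
  have := mul_le_mul_of_nonneg_left h3 (inv_nonneg.mpr hd.le)
  have hC : (P.degree : ℝ)⁻¹ * ((n + 1) * (P.degree * Real.log 2)) = (n + 1) * Real.log 2 := by
    field_simp
  calc (n : ℝ) * ((P.degree : ℝ)⁻¹ * logHeight₁ x) = (P.degree : ℝ)⁻¹ * (n * logHeight₁ x) := by ring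
    _ ≤ (P.degree : ℝ)⁻¹ * ((n + 1) * (P.degree * Real.log 2) + logHeight₁ (1 - (1 - x) ^ n)) := this
    _ = (P.degree : ℝ)⁻¹ * logHeight₁ (1 - (1 - x) ^ n) + (n + 1) * Real.log 2 := by
        rw [mul_add, hC, add_comm]

/-- **TRANSFER ALONG `x ↦ 1 − (1−x)^n`**: Vojta with `ε ≥ 0` on `T` in degree `≤ d` and `ε(n−1) < 1`
imply Vojta with `(1+ε)/(1 − ε(n−1)) − 1` in degree `≤ d` on the points whose `γ'_n`-image
`(ℚ(γ'_n x), γ'_n x)` lies in `T`. [cite: MochizukiGenEll2010, Thm 2.1 p.13] -/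
theorem vojtaIneq_transfer_oneSubPow {n : ℕ} (hn : 1 ≤ n) {T : Set NFPoint} {d : ℕ} {ε : ℝ}
    (hε : 0 ≤ ε) (hεn : ε * (n - 1) < 1) (hV : VojtaIneq T d ε) :
    VojtaIneq ((P1FiniteMap.oneSubPow n).preimageSet T) d ((1 + ε) / (1 - ε * (n - 1)) - 1) := by
  have hcast : (((P1FiniteMap.oneSubPowReduced n hn).B.deg : ℕ) : ℝ) = (n : ℝ) - 1 := by
    rw [P1FiniteMap.oneSubPowReduced_B_deg, Nat.cast_sub hn, Nat.cast_one]
  have hdeg : ((P1FiniteMap.oneSubPow n).deg : ℝ) = n := rfl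
  have ha : (1 + ε) * ((P1FiniteMap.oneSubPowReduced n hn).B.deg : ℝ) <
      (P1FiniteMap.oneSubPow n).deg := by
    rw [hcast, hdeg]; nlinarith
  have h := vojtaIneq_transfer (P1FiniteMap.oneSubPowReduced n hn) (hlow_oneSubPow n) hε ha hV
  rw [hcast, hdeg] at h
  have he : (n : ℝ) - (1 + ε) * (n - 1) = 1 - ε * (n - 1) := by ring
  rwa [he] at h

end NFPoint

/-! ## `γ''_n : x ↦ x^n / (x^n − (x−1)^n) = M((Mx)^n)`, `M(x) = x/(x−1)` -/

namespace P1FiniteMap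

/-- `deg (t^n − (t−1)^n) < n` (the leading terms cancel). [folklore] -/
private theorem natDegree_X_pow_sub_X_sub_one_pow_le (n : ℕ) (hn : 1 ≤ n) :
    (X ^ n - (X - 1) ^ n : ℤ[X]).natDegree ≤ n - 1 := by
  have hq : (X - 1 : ℤ[X]) = X - C 1 := by rw [C_1]
  have hdeg : (X ^ n : ℤ[X]).degree = ((X - 1) ^ n : ℤ[X]).degree := by
    rw [degree_X_pow, hq, degree_pow, degree_X_sub_C, nsmul_eq_mul, mul_one]
  have hlc : (X ^ n : ℤ[X]).leadingCoeff = ((X - 1) ^ n : ℤ[X]).leadingCoeff := by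
    rw [leadingCoeff_X_pow, hq, leadingCoeff_pow, leadingCoeff_X_sub_C, one_pow]
  have hlt := degree_sub_lt hdeg (pow_ne_zero _ X_ne_zero) hlc
  rw [degree_X_pow] at hlt
  rcases eq_or_ne (X ^ n - (X - 1) ^ n : ℤ[X]) 0 with h0 | h0
  · rw [h0, natDegree_zero]; exact Nat.zero_le _
  · have : (X ^ n - (X - 1) ^ n : ℤ[X]).natDegree < n :=
      (natDegree_lt_iff_degree_lt h0).mpr (by exact_mod_cast hlt)
    omega

/-- `t^n − (t−1)^n ≠ 0` for `n ≥ 1` (value `−(−1)^n` at `t = 0`). [folklore] -/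
private theorem X_pow_sub_X_sub_one_pow_ne_zero (n : ℕ) (hn : 1 ≤ n) :
    (X ^ n - (X - 1) ^ n : ℤ[X]) ≠ 0 := by
  intro h
  have := congrArg (Polynomial.eval 0) h
  simp only [eval_sub, eval_pow, eval_X, eval_one, zero_sub, eval_zero] at this
  rw [zero_pow (by omega), zero_sub, neg_eq_zero] at this
  exact pow_ne_zero n (neg_ne_zero.mpr one_ne_zero) this

/-- The map `γ''_n = (t^n : t^n − (t−1)^n) : ℙ¹ → ℙ¹`, `x ↦ x^n/(x^n − (x−1)^n)` — the conjugate of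
`x ↦ x^n` by the involution `M(x) = x/(x−1)` (which swaps `1` and `∞` and fixes `0`).
[cite: MochizukiGenEll2010, Thm 2.1 p.13] -/
def powDivPow (n : ℕ) : P1FiniteMap where
  num := X ^ n
  den := X ^ n - (X - 1) ^ n
  deg := n
  natDegree_num_le := by rw [natDegree_X_pow]
  natDegree_den_le := (natDegree_sub_le _ _).trans (max_le (by rw [natDegree_X_pow])
    (natDegree_pow_le.trans (by
      rw [← C_1, natDegree_X_sub_C, mul_one])))

/-- `γ''_n(x) = x^n/(x^n − (x−1)^n)`. [cite: MochizukiGenEll2010, Thm 2.1 p.13] -/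
@[simp] theorem eval_powDivPow (n : ℕ) {F : Type*} [Field F] (x : F) :
    (powDivPow n).eval x = x ^ n / (x ^ n - (x - 1) ^ n) := by
  simp [eval, powDivPow]

/-- THE REDUCED-PULLBACK CERTIFICATE of `γ''_n`: `B'' = V(t^n − (t−1)^n)` (the points `M(ζ)`,
`ζ ∈ μ_n ∖ {1}`), `deg B'' = n − 1`, `k = n`, `c = 1`, `h = (B'')^{n−1}`:
`t^n · (t^n − (t−1)^n) · (t−1)^n · (B'')^{n−1} = ((t²−t) B'')^n`. [cite: MochizukiGenEll2010, Prop 1.7 p.9] -/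
def powDivPowReduced (n : ℕ) (hn : 1 ≤ n) : ReducedPullback (powDivPow n) where
  B := { poly := X ^ n - (X - 1) ^ n
         deg := n - 1
         natDegree_le := natDegree_X_pow_sub_X_sub_one_pow_le n hn }
  k := n
  one_le_k := hn
  c := 1
  c_ne_zero := one_ne_zero
  h := (X ^ n - (X - 1) ^ n) ^ (n - 1)
  hdiv := by
    change X ^ n * (X ^ n - (X - 1) ^ n) * (X ^ n - (X ^ n - (X - 1) ^ n)) *
        (X ^ n - (X - 1) ^ n) ^ (n - 1) =
      C 1 * ((X ^ 2 - X) * (X ^ n - (X - 1) ^ n)) ^ n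
    set B : ℤ[X] := X ^ n - (X - 1) ^ n with hB
    have hBn : B * B ^ (n - 1) = B ^ n := by rw [← pow_succ', Nat.sub_add_cancel hn]
    rw [map_one, one_mul, show (X ^ n - B : ℤ[X]) = (X - 1) ^ n by rw [hB]; ring,
      show (X ^ 2 - X : ℤ[X]) = X * (X - 1) by ring, mul_pow, mul_pow]
    calc X ^ n * B * (X - 1) ^ n * B ^ (n - 1) = X ^ n * (X - 1) ^ n * (B * B ^ (n - 1)) := by ring
      _ = X ^ n * (X - 1) ^ n * B ^ n := by rw [hBn]
  hdeg := by
    change ((X ^ n - (X - 1) ^ n) ^ (n - 1) : ℤ[X]).natDegree + 3 * n ≤ n * (3 + (n - 1))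
    have h1 := natDegree_X_pow_sub_X_sub_one_pow_le n hn
    have h2 : ((X ^ n - (X - 1) ^ n) ^ (n - 1) : ℤ[X]).natDegree ≤ (n - 1) * (n - 1) :=
      natDegree_pow_le.trans (Nat.mul_le_mul_left _ h1)
    obtain ⟨m, rfl⟩ : ∃ m, n = m + 1 := ⟨n - 1, by omega⟩
    simp only [Nat.add_sub_cancel] at h2 ⊢
    nlinarith
  j := 1
  hBdiv := by
    change (X ^ n - (X - 1) ^ n : ℤ[X]) ∣
      (X ^ n * (X ^ n - (X - 1) ^ n) * (X ^ n - (X ^ n - (X - 1) ^ n))) ^ 1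
    rw [pow_one]
    exact Dvd.dvd.mul_right (dvd_mul_left _ _) _
  ne_zero := by
    change (X ^ n * (X ^ n - (X - 1) ^ n) * (X ^ n - (X ^ n - (X - 1) ^ n)) : ℤ[X]) ≠ 0
    rw [show (X ^ n - (X ^ n - (X - 1) ^ n) : ℤ[X]) = (X - 1) ^ n by ring]
    refine mul_ne_zero (mul_ne_zero (pow_ne_zero _ X_ne_zero) (X_pow_sub_X_sub_one_pow_ne_zero n hn))
      (pow_ne_zero _ ?_)
    rw [← C_1]; exact X_sub_C_ne_zero 1

/-- `deg B'' = n − 1`. [cite: MochizukiGenEll2010, Prop 1.7 p.9] -/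
@[simp] theorem powDivPowReduced_B_deg (n : ℕ) (hn : 1 ≤ n) :
    (powDivPowReduced n hn).B.deg = n - 1 := rfl

end P1FiniteMap

namespace NFPoint

/-- `h(z/(z−1)) ≤ 2·[K:ℚ]·log 2 + h(z)` for `z ≠ 1` (`z/(z−1) = 1 + (z−1)⁻¹`). [folklore] -/
private theorem logHeight₁_div_sub_one_le {K : Type*} [Field K] [NumberField K] (z : K) (hz : z ≠ 1) :
    logHeight₁ (z / (z - 1)) ≤ 2 * (totalWeight K * Real.log 2) + logHeight₁ z := by
  have hz1 : z - 1 ≠ 0 := sub_ne_zero.mpr hz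
  have hid : z / (z - 1) = 1 + (z - 1)⁻¹ := by field_simp; ring
  rw [hid]
  have h1 := logHeight₁_add_le (1 : K) (z - 1)⁻¹
  rw [logHeight₁_one, add_zero, logHeight₁_inv] at h1
  have h2 := logHeight₁_sub_le z (1 : K)
  rw [logHeight₁_one, add_zero] at h2
  linarith

/-- `h(z) ≤ 2·[K:ℚ]·log 2 + h(z/(z−1))` for `z ≠ 1` (`M(x) = x/(x−1)` is an involution). [folklore] -/
private theorem logHeight₁_le_div_sub_one {K : Type*} [Field K] [NumberField K] (z : K) (hz : z ≠ 1) :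
    logHeight₁ z ≤ 2 * (totalWeight K * Real.log 2) + logHeight₁ (z / (z - 1)) := by
  have hz1 : z - 1 ≠ 0 := sub_ne_zero.mpr hz
  have hw : z / (z - 1) ≠ 1 := by
    rw [Ne, div_eq_one_iff_eq hz1]; intro h; exact one_ne_zero (by linear_combination h)
  have hinv : z / (z - 1) / (z / (z - 1) - 1) = z := by
    field_simp
    ring
  have := logHeight₁_div_sub_one_le (z / (z - 1)) hw
  rwa [hinv] at this

/-- THE HEIGHT LOWER BOUND for `γ''_n`: `n·ht(x) ≤ ht(γ''_n(x)) + (2n+2)·log 2`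
(`γ''_n = M ∘ (·)^n ∘ M`, `|h(Mz) − h(z)| ≤ 2[F:ℚ] log 2`, `h(u^n) = n h(u)`; [GenEll] Prop. 1.4 (i),
(iii)). [cite: MochizukiGenEll2010, Prop 1.4 (i) p.6] -/
theorem hlow_powDivPow (n : ℕ) : ∀ P : NFPoint, P.OffDiv (P1FiniteMap.powDivPow n).pullbackCusps →
    ((P1FiniteMap.powDivPow n).deg : ℝ) * P.ht ≤
      (P.degree : ℝ)⁻¹ * logHeight₁ ((P1FiniteMap.powDivPow n).eval P.x) + (2 * n + 2) * Real.log 2 := by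
  intro P hP
  rw [P1FiniteMap.eval_powDivPow]
  change (n : ℝ) * ((P.degree : ℝ)⁻¹ * logHeight₁ P.x) ≤ _
  set x := P.x with hx
  -- non-degeneracy from `x ∉ γ''⁻¹(C)`
  have hoff : aeval P.x (X ^ n * (X ^ n - (X - 1) ^ n) * (X ^ n - (X ^ n - (X - 1) ^ n)) : ℤ[X]) ≠ 0 :=
    hP
  simp only [map_mul, map_sub, map_pow, aeval_X, map_one, ← hx] at hoff
  have hx1 : x ≠ 1 := by
    intro h; apply hoff; rw [h]; simp [zero_pow (show n ≠ 0 by rintro rfl; simp at hoff)]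
  have hB : x ^ n - (x - 1) ^ n ≠ 0 := fun h => hoff (by rw [h]; ring)
  have hx10 : x - 1 ≠ 0 := sub_ne_zero.mpr hx1
  set u : P.F := x / (x - 1) with hu
  have hun : u ^ n ≠ 1 := by
    intro h
    apply hB
    rw [hu, div_pow, div_eq_one_iff_eq (pow_ne_zero _ hx10)] at h
    rw [h, sub_self]
  -- `γ''(x) = M(u^n)`
  have hid : x ^ n / (x ^ n - (x - 1) ^ n) = u ^ n / (u ^ n - 1) := by
    rw [hu, div_pow]
    field_simp
  rw [hid]
  have htw : (totalWeight P.F : ℝ) = P.degree := by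
    rw [NumberField.totalWeight_eq_finrank]; rfl
  have h1 : logHeight₁ x ≤ 2 * (totalWeight P.F * Real.log 2) + logHeight₁ u := logHeight₁_le_div_sub_one x hx1
  have h2 : logHeight₁ (u ^ n) ≤ 2 * (totalWeight P.F * Real.log 2) + logHeight₁ (u ^ n / (u ^ n - 1)) :=
    logHeight₁_le_div_sub_one (u ^ n) hun
  rw [logHeight₁_pow] at h2
  rw [htw] at h1 h2
  have hd : (0 : ℝ) < P.degree := Nat.cast_pos.mpr P.degree_pos
  have hn0 : (0 : ℝ) ≤ n := Nat.cast_nonneg n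
  have h3 : (n : ℝ) * logHeight₁ x ≤
      (2 * n + 2) * (P.degree * Real.log 2) + logHeight₁ (u ^ n / (u ^ n - 1)) := by
    nlinarith
  have := mul_le_mul_of_nonneg_left h3 (inv_nonneg.mpr hd.le)
  have hC : (P.degree : ℝ)⁻¹ * ((2 * n + 2) * (P.degree * Real.log 2)) = (2 * n + 2) * Real.log 2 := by
    field_simp
  calc (n : ℝ) * ((P.degree : ℝ)⁻¹ * logHeight₁ x) = (P.degree : ℝ)⁻¹ * (n * logHeight₁ x) := by ring
    _ ≤ (P.degree : ℝ)⁻¹ * ((2 * n + 2) * (P.degree * Real.log 2) + logHeight₁ (u ^ n / (u ^ n - 1))) :=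
        this
    _ = (P.degree : ℝ)⁻¹ * logHeight₁ (u ^ n / (u ^ n - 1)) + (2 * n + 2) * Real.log 2 := by
        rw [mul_add, hC, add_comm]

/-- **TRANSFER ALONG `x ↦ x^n/(x^n − (x−1)^n)`**: Vojta with `ε ≥ 0` on `T` in degree `≤ d` and
`ε(n−1) < 1` imply Vojta with `(1+ε)/(1 − ε(n−1)) − 1` in degree `≤ d` on the points whose
`γ''_n`-image lies in `T`. [cite: MochizukiGenEll2010, Thm 2.1 p.13] -/
theorem vojtaIneq_transfer_powDivPow {n : ℕ} (hn : 1 ≤ n) {T : Set NFPoint} {d : ℕ} {ε : ℝ}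
    (hε : 0 ≤ ε) (hεn : ε * (n - 1) < 1) (hV : VojtaIneq T d ε) :
    VojtaIneq ((P1FiniteMap.powDivPow n).preimageSet T) d ((1 + ε) / (1 - ε * (n - 1)) - 1) := by
  have hcast : (((P1FiniteMap.powDivPowReduced n hn).B.deg : ℕ) : ℝ) = (n : ℝ) - 1 := by
    rw [P1FiniteMap.powDivPowReduced_B_deg, Nat.cast_sub hn, Nat.cast_one]
  have hdeg : ((P1FiniteMap.powDivPow n).deg : ℝ) = n := rfl
  have ha : (1 + ε) * ((P1FiniteMap.powDivPowReduced n hn).B.deg : ℝ) <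
      (P1FiniteMap.powDivPow n).deg := by
    rw [hcast, hdeg]; nlinarith
  have h := vojtaIneq_transfer (P1FiniteMap.powDivPowReduced n hn) (hlow_powDivPow n) hε ha hV
  rw [hcast, hdeg] at h
  have he : (n : ℝ) - (1 + ε) * (n - 1) = 1 - ε * (n - 1) := by ring
  rwa [he] at h

end NFPoint

end Literature.NumberTheory.DiophantineGeometry.GenEll

end
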